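import Summits.BirchSwinnertonDyer.BirchSwinnertonDyer.Theorems.RamifiedHeegnerPairLeafPartnerOrdersBaseChangeLattice
import Summits.BirchSwinnertonDyer.BirchSwinnertonDyer.Theorems.RamifiedHeegnerPairLeafPartnerOrdersBaseChangeC5
import HarnessLib

/-!
# Route `RamifiedHeegnerPair`, crux U₁ `LeafRankOneUpperAtThree` (stmt-BirchSwinnertonDyer-26022), line `partnerdescent` —
# partner kernel, base change (α) part 6: DICTIONARY over `ℤ₃` — exact Eisenstein, the projector identities and (C5′) read on `B̂`, `Ŷ`

HONEST FRAMING. Theorems only; helper file (`--supports stmt-BirchSwinnertonDyer-26022 --as helper`); elementary linear algebra at `ℤ₃ = ℤ_[3]`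
continuing ‹…BaseChangeLattice› and ‹…BaseChangeC5›; no number theory, no named fact, no `sorry`; nothing booked; BSD is proved for no curve.
Lead prover bsd-line-rhp-p2 g64, 2026-08-31.

WHAT (all in ACTION-ONLY form: an endomorphism `f ∈ End M` «acts as» an integer matrix `X` when `(f m)^ = X̂ m`):
* `exists_forall_dotProduct_twist_eq` — the INTEGRAL exact-Eisenstein statement for the twisted pairing «for each `k` there is `z ∈ B` with
  `z·(D_w W b) = (U b)_k − κ b_k` for all `b ∈ B`» gives, over `ℤ₃`, vectors `x_k ∈ M` with `x_k·(P̂ m) = ((Û − κ) m)_k` for all `m ∈ M`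
  (the input of `forall_exists_pairing_eq_comp_of_basis`, p812051, on the basis of ‹BaseChangeCoordinates› `exists_basis_coord_eq`);
* `smul_apply_eq_smul_of_forall` — `δ·(t y) = N·Ψ(y)·π^*1` on `Y` ⟹ `δ·(t̂ m) = N·P̂ m` on the `ℤ₃`-span of `Ŷ` (`P̂ m = Ψ̂(m)·(π^*1)^`);
* `exists_mem_smul_apply_eq_of_forall` — `Rl·(t y) ∈ N·Y` on `Y` ⟹ `Rl·(t̂ m) ∈ N·Ŷ`;
* `intCast_dvd_of_forall_smul_apply_eq` — (C5′) over `ℤ₃` for every `a ∈ ℤ₃[s]` from the integral (C5′), via ‹BaseChangeC5›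
  `intCast_dvd_of_integral_congruence` (finite presentation of `a` by `Submodule.mem_span_set'`, finite generation of `Y`).
[cite: PapikianRabinoff2016, §3 ¶23, Lemma 24] [cite: Matsumura1987, Thm. 7.6] [cite: Gross1987, §1–§2]
-/

set_option linter.dupNamespace false
set_option autoImplicit false

noncomputable section

namespace Summit.BirchSwinnertonDyer.BirchSwinnertonDyer.Theorems.LeafPartnerOrders

open Matrix

variable {ι : Type*} [Fintype ι] [DecidableEq ι]

omit [DecidableEq ι] in
/-- `(z·v)^ = ẑ·v̂`. [folklore] -/
theorem intCast_dotProduct {S : Type*} [CommRing S] (z v : ι → ℤ) :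
    (((z ⬝ᵥ v : ℤ)) : S) = (fun c ↦ ((z c : ℤ) : S)) ⬝ᵥ fun c ↦ ((v c : ℤ) : S) := by
  simp [dotProduct, Int.cast_sum, Int.cast_mul]

/-- **Exact Eisenstein for the twisted pairing, read over `ℤ₃`.** [cite: Gross1987, §1–§2] [cite: Mazur1977, II §15] -/
theorem exists_forall_dotProduct_twist_eq (M : Submodule ℤ_[3] (ι → ℤ_[3])) (hM : ∀ v : ι → ℤ_[3], v ∈ M ↔ ∑ c, v c = 0)
    (P U : Matrix ι ι ℤ) (κ : ℤ) (fU : Module.End ℤ_[3] M)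
    (hfU : ∀ m : M, ((fU m : M) : ι → ℤ_[3]) = U.map (Int.castRingHom ℤ_[3]) *ᵥ (m : ι → ℤ_[3]))
    (hEis : ∀ k : ι, ∃ z : ι → ℤ, ∑ c, z c = 0 ∧ ∀ b : ι → ℤ, ∑ c, b c = 0 → z ⬝ᵥ (P *ᵥ b) = (U *ᵥ b) k - κ * b k)
    (k : ι) :
    ∃ x : M, ∀ m : M, (x : ι → ℤ_[3]) ⬝ᵥ (P.map (Int.castRingHom ℤ_[3]) *ᵥ (m : ι → ℤ_[3])) =
      (((fU m : M) : ι → ℤ_[3]) - (κ : ℤ_[3]) • (m : ι → ℤ_[3])) k := by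
  obtain ⟨z, hz, hzb⟩ := hEis k
  have hzM : (fun c ↦ ((z c : ℤ) : ℤ_[3])) ∈ M := by
    rw [hM]
    have : ((∑ c, z c : ℤ) : ℤ_[3]) = 0 := by rw [hz, Int.cast_zero]
    rwa [Int.cast_sum] at this
  refine ⟨⟨_, hzM⟩, fun m ↦ ?_⟩
  rw [hfU]
  have hspan := mem_span_intCast_degreeZero M hM k m
  induction hspan using Submodule.span_induction with
  | mem m hm =>
      obtain ⟨b, hb, hmb⟩ := hm
      rw [hmb]
      have h2 : (((z ⬝ᵥ (P *ᵥ b) : ℤ)) : ℤ_[3]) = (((U *ᵥ b) k - κ * b k : ℤ) : ℤ_[3]) := by rw [hzb b hb]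
      rw [intCast_dotProduct, map_intCast_mulVec'] at h2
      change (fun c ↦ ((z c : ℤ) : ℤ_[3])) ⬝ᵥ (P.map (Int.castRingHom ℤ_[3]) *ᵥ fun c ↦ ((b c : ℤ) : ℤ_[3])) = _
      rw [h2, Pi.sub_apply, Pi.smul_apply, ← map_intCast_mulVec', smul_eq_mul, Int.cast_sub, Int.cast_mul]
  | zero => simp
  | add m m' _ _ ih ih' =>
      rw [Submodule.coe_add, mulVec_add, dotProduct_add, ih, ih', mulVec_add, smul_add]
      simp only [Pi.sub_apply, Pi.add_apply]
      ring
  | smul a m _ ih =>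
      rw [Submodule.coe_smul, mulVec_smul, dotProduct_smul, ih, mulVec_smul, smul_comm]
      simp only [Pi.sub_apply, Pi.smul_apply, smul_eq_mul]
      ring

omit [DecidableEq ι] in
/-- **`δ·(t y) = N·Ψ(y)·π^*1` on `T` ⟹ `δ·(t̂ m) = N·P̂ m` on the `ℤ₃`-span of `T̂`.** [cite: Takahashi2001, Thm. 2.3] -/
theorem smul_apply_eq_smul_of_forall (M : Submodule ℤ_[3] (ι → ℤ_[3])) (T : Set (ι → ℤ)) (ft : Module.End ℤ_[3] M) (t : Matrix ι ι ℤ)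
    (hft : ∀ m : M, ((ft m : M) : ι → ℤ_[3]) = t.map (Int.castRingHom ℤ_[3]) *ᵥ (m : ι → ℤ_[3]))
    (Ψ : (ι → ℤ) →ₗ[ℤ] ℤ) (Ψ' : (ι → ℤ_[3]) →ₗ[ℤ_[3]] ℤ_[3]) (hΨ' : ∀ y : ι → ℤ, Ψ' (fun c ↦ ((y c : ℤ) : ℤ_[3])) = ((Ψ y : ℤ) : ℤ_[3]))
    (pb1 : ι → ℤ) (Pf : M → M) (hPf : ∀ m : M, ((Pf m : M) : ι → ℤ_[3]) = Ψ' (m : ι → ℤ_[3]) • fun c ↦ ((pb1 c : ℤ) : ℤ_[3]))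
    (δ N : ℤ) (hP : ∀ y ∈ T, δ • (t *ᵥ y) = N • Ψ y • pb1) (m : M)
    (hm : m ∈ Submodule.span ℤ_[3] {m : M | ∃ y ∈ T, (m : ι → ℤ_[3]) = fun c ↦ ((y c : ℤ) : ℤ_[3])}) :
    (δ : ℤ_[3]) • ft m = (N : ℤ_[3]) • Pf m := by
  induction hm using Submodule.span_induction with
  | mem m hm =>
      obtain ⟨y, hy, hmy⟩ := hm
      apply Subtype.ext
      rw [Submodule.coe_smul, Submodule.coe_smul, hft, hPf, hmy, ← map_intCast_mulVec', hΨ' y]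
      have h1 := congrArg (fun v : ι → ℤ ↦ fun c ↦ ((v c : ℤ) : ℤ_[3])) (hP y hy)
      rw [intCast_vec_smul, intCast_vec_smul] at h1
      rw [h1]
      funext c
      simp only [Pi.smul_apply, smul_eq_mul, Int.cast_mul]
  | zero =>
      apply Subtype.ext
      rw [map_zero, smul_zero, Submodule.coe_zero, Submodule.coe_smul, hPf, Submodule.coe_zero, map_zero, zero_smul]
      exact (smul_zero _).symm
  | add m m' _ _ ih ih' =>
      rw [map_add, smul_add, ih, ih', ← smul_add]
      congr 1
      apply Subtype.ext
      rw [hPf, Submodule.coe_add, Submodule.coe_add, hPf, hPf, map_add, add_smul]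
  | smul a m _ ih =>
      rw [map_smul, smul_comm, ih, smul_comm]
      congr 1
      apply Subtype.ext
      rw [hPf, Submodule.coe_smul, Submodule.coe_smul, hPf, map_smul, smul_eq_mul, mul_smul]

omit [DecidableEq ι] in
/-- **`Rl·(t y) ∈ N·Y` on `T` ⟹ `Rl·(t̂ m) ∈ N·Ŷ` on the `ℤ₃`-span of `T̂`** (`Ŷ` any submodule containing the `ŷ'`, `y' ∈ T'`).
[cite: Takahashi2001, Lemma 2.2] -/
theorem exists_mem_smul_apply_eq_of_forall (M : Submodule ℤ_[3] (ι → ℤ_[3])) (T T' : Set (ι → ℤ)) (ft : Module.End ℤ_[3] M)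
    (t : Matrix ι ι ℤ) (hft : ∀ m : M, ((ft m : M) : ι → ℤ_[3]) = t.map (Int.castRingHom ℤ_[3]) *ᵥ (m : ι → ℤ_[3]))
    (Yh : Submodule ℤ_[3] M) (hT' : ∀ y ∈ T', ∃ hy : (fun c ↦ ((y c : ℤ) : ℤ_[3])) ∈ M, (⟨_, hy⟩ : M) ∈ Yh)
    (Rl N : ℤ) (hlat : ∀ y ∈ T, ∃ y' ∈ T', Rl • (t *ᵥ y) = N • y') (m : M)
    (hm : m ∈ Submodule.span ℤ_[3] {m : M | ∃ y ∈ T, (m : ι → ℤ_[3]) = fun c ↦ ((y c : ℤ) : ℤ_[3])}) :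
    ∃ m' ∈ Yh, (Rl : ℤ_[3]) • ft m = (N : ℤ_[3]) • m' := by
  induction hm using Submodule.span_induction with
  | mem m hm =>
      obtain ⟨y, hy, hmy⟩ := hm
      obtain ⟨y', hy', hyy'⟩ := hlat y hy
      obtain ⟨hy'M, hy'Y⟩ := hT' y' hy'
      refine ⟨⟨_, hy'M⟩, hy'Y, Subtype.ext ?_⟩
      rw [Submodule.coe_smul, Submodule.coe_smul, hft, hmy, ← map_intCast_mulVec']
      have h1 := congrArg (fun v : ι → ℤ ↦ fun c ↦ ((v c : ℤ) : ℤ_[3])) hyy'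
      rw [intCast_vec_smul, intCast_vec_smul] at h1
      exact h1
  | zero => exact ⟨0, Submodule.zero_mem _, by rw [map_zero, smul_zero, smul_zero]⟩
  | add m m' _ _ ih ih' =>
      obtain ⟨n, hn, h⟩ := ih
      obtain ⟨n', hn', h'⟩ := ih'
      exact ⟨n + n', Submodule.add_mem _ hn hn', by rw [map_add, smul_add, h, h', smul_add]⟩
  | smul a m _ ih =>
      obtain ⟨n, hn, h⟩ := ih
      exact ⟨a • n, Submodule.smul_mem _ a hn, by rw [map_smul, smul_comm, h, smul_comm]⟩

/-- **(C5′) over `ℤ₃` for every `a ∈ ℤ₃[s]`** from the integral (C5′). Here each `f ∈ s` acts as some `X ∈ G`, `Ŷ` contains the `ŷ`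
(`y ∈ Y`), `P̂ m = Ψ̂(m)·(π^*1)^`, and the hypothesis is «`δ·(a m) = c·P̂ m` for all `m ∈ Ŷ`»; conclusion `δ ∣ c` in `ℤ₃`.
[cite: PapikianRabinoff2016, §3 ¶23, Lemma 24] [cite: Matsumura1987, Thm. 7.6] -/
theorem intCast_dvd_of_forall_smul_apply_eq (M : Submodule ℤ_[3] (ι → ℤ_[3])) (G : Set (Matrix ι ι ℤ))
    (s : Set (Module.End ℤ_[3] M))
    (hs' : ∀ f ∈ s, ∃ X ∈ G, ∀ m : M, ((f m : M) : ι → ℤ_[3]) = X.map (Int.castRingHom ℤ_[3]) *ᵥ (m : ι → ℤ_[3]))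
    (Y : Submodule ℤ (ι → ℤ)) (Yh : Submodule ℤ_[3] M)
    (hYh : ∀ y ∈ Y, ∃ hy : (fun c ↦ ((y c : ℤ) : ℤ_[3])) ∈ M, (⟨_, hy⟩ : M) ∈ Yh)
    (Ψ : (ι → ℤ) →ₗ[ℤ] ℤ) (Ψ' : (ι → ℤ_[3]) →ₗ[ℤ_[3]] ℤ_[3]) (hΨ' : ∀ y : ι → ℤ, Ψ' (fun c ↦ ((y c : ℤ) : ℤ_[3])) = ((Ψ y : ℤ) : ℤ_[3]))
    (pb1 : ι → ℤ) (Pf : M → M) (hPf : ∀ m : M, ((Pf m : M) : ι → ℤ_[3]) = Ψ' (m : ι → ℤ_[3]) • fun c ↦ ((pb1 c : ℤ) : ℤ_[3]))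
    (δ : ℤ) (hC5 : ∀ C ∈ Algebra.adjoin ℤ G, ∀ a : ℤ, (∀ y ∈ Y, δ • (C *ᵥ y) = a • Ψ y • pb1) → δ ∣ a)
    {a : Module.End ℤ_[3] M} (ha : a ∈ Algebra.adjoin ℤ_[3] s) (c : ℤ_[3])
    (hac : ∀ m ∈ Yh, (δ : ℤ_[3]) • a m = c • Pf m) : (δ : ℤ_[3]) ∣ c := by
  classical
  -- `a` as a finite `ℤ₃`-combination of operators `b̂_k`, `b_k ∈ ℤ[G]`
  have hspan := mem_span_of_mem_adjoin_restricted M G s hs' ha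
  obtain ⟨n, e, gk, hsum⟩ := Submodule.mem_span_set'.mp hspan
  choose bk hbk hbk_act using fun k : Fin n ↦ (gk k).2
  -- a finite generating family of `Y`
  obtain ⟨Sfin, hSfin⟩ := (inferInstance : IsNoetherian ℤ (ι → ℤ)).noetherian Y
  have hYle : Y ≤ Submodule.span ℤ (Set.range (Subtype.val : Sfin → (ι → ℤ))) := by
    rw [Subtype.range_coe_subtype, Finset.setOf_mem, hSfin]
  have hyY : ∀ jj : Sfin, (jj : ι → ℤ) ∈ Y := fun jj ↦ hSfin ▸ Submodule.subset_span jj.2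
  refine intCast_dvd_of_integral_congruence (S := ℤ_[3]) G Y pb1 Ψ δ hC5 bk hbk (Subtype.val : Sfin → (ι → ℤ)) hYle e c
    fun jj ↦ ?_
  obtain ⟨hmjM, hmjY⟩ := hYh _ (hyY jj)
  have h1 := congrArg Subtype.val (hac _ hmjY)
  simp only [← hsum, LinearMap.sum_apply, LinearMap.smul_apply, Submodule.coe_smul, AddSubmonoidClass.coe_finsetSum,
    hPf, hbk_act, hΨ'] at h1
  exact h1

end Summit.BirchSwinnertonDyer.BirchSwinnertonDyer.Theorems.LeafPartnerOrders

end
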